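import Literature.AlgebraicGeometry.Resolution.RoofCoreE
import Literature.AlgebraicGeometry.Resolution.DiscChartMembers
import Mathlib.FieldTheory.Minpoly.IsIntegrallyClosed
import HarnessLib

/-!
# The E-chart from a standard-étale identity, without minimality of `f`

Topic: `Literature/AlgebraicGeometry/Resolution`. M. Temkin, *Inseparable local uniformization*,
J. Algebra 373 (2013) = arXiv:0804.1554v3, Thm. 3.3.1, smooth-fibre case (tree:
`Temkin2013RelativeCurveSmoothFibre`), driver of the roof construction. `RoofCoreE
.exists_EChart_with_members` (after `EChart.exists_EChart`) builds the `m°`-side chart from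
standard-étale data `(f, g, h, p₂, s)` for `η` over the disc chart `B = m°[x′][1/u]`, and asks
`f` to be of MINIMAL degree among the polynomials over `m(x)` vanishing at `η` (`hfmin`). In the
driver the data are computed over a SMALLER constant field `m₁ ⊆ m` (before the centre `a ∈ m`
of the disc is chosen — the zeros and poles of their coefficients must be avoided by the disc),
and `f`, minimal over `m₁(x)`, need not stay minimal over `m(x)`. This file removes `hfmin`:
`B` is integrally closed with `m(x) ⊆ Frac B`, so the minimal polynomial `f₂` of `η` over `B`
has coefficients in `B`, divides `f = f₂ f₃` in `B[X]`, is minimal over `m(x)` (clearing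
denominators), and inherits the identity `gˢ = f′h + f p₂ = f₂′(f₃h) + f₂(f₃′h + f₃p₂)`.

* `exists_EChart_with_members_of_identity` — `exists_EChart_with_members` without `hfmin` —
  PROVED.

Everything is [folklore] bookkeeping; no definitions, no named facts.

## Sources

* M. Temkin, arXiv:0804.1554v3, proof of Thm. 3.3.1, Steps 3–4 (p. 45). [Temkin2013]
* H. Knaf, F.-V. Kuhlmann, 2005/2009 (standard-étale normal forms), through the tree.
-/

noncomputable section

open Polynomial

namespace Literature.AlgebraicGeometry.Resolution

universe u

variable {Ω : Type u} [Field Ω] (V : ValuationSubring Ω) (m : Subfield Ω)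

set_option maxHeartbeats 3200000 in
set_option synthInstance.maxHeartbeats 200000 in
/-- **The E-chart with prescribed members, from a standard-étale identity** — the statement of
`exists_EChart_with_members` with the minimality hypothesis `hfmin` on `f` removed.
[cite: Temkin2013, Thm. 3.3.1 (proof, Steps 3–4)] -/
theorem exists_EChart_with_members_of_identity {x a₀ c₀ : Ω}
    (hxaV : V.valuation (x - a₀) ≤ V.valuation c₀)
    (htr : Transcendental (V.toSubring ⊓ m.toSubring : Subring Ω) ((x - a₀) / c₀))
    {u : Ω} (hu : u ∈ Algebra.adjoin (V.toSubring ⊓ m.toSubring : Subring Ω) ({(x - a₀) / c₀} : Set Ω))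
    (hvu : V.valuation u = 1)
    {η : Ω} (hηV : η ∈ V) (f g h p₂ : Polynomial Ω) (s : ℕ) (hfmon : f.Monic) (hfη : f.eval η = 0)
    (hcoef : ∀ Q ∈ ({f, g, h, p₂} : Set (Polynomial Ω)), ∀ k,
      Q.coeff k ∈ locAway (Algebra.adjoin (V.toSubring ⊓ m.toSubring : Subring Ω)
        ({(x - a₀) / c₀} : Set Ω)) u hu)
    (hident : derivative f * h + f * p₂ = g ^ s) (hvg : V.valuation (g.eval η) = 1)
    (ha₀ : a₀ ∈ m) (hc₀ : c₀ ∈ m) (hc₀0 : c₀ ≠ 0)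
    (Z : Finset Ω) (hZ : ∀ z ∈ Z, ∃ (az bz : Polynomial Ω) (k : ℕ),
      (∀ j, az.coeff j ∈ locAway (Algebra.adjoin (V.toSubring ⊓ m.toSubring : Subring Ω)
          ({(x - a₀) / c₀} : Set Ω)) u hu ∧
        bz.coeff j ∈ locAway (Algebra.adjoin (V.toSubring ⊓ m.toSubring : Subring Ω)
          ({(x - a₀) / c₀} : Set Ω)) u hu) ∧
      V.valuation (bz.eval η) = 1 ∧ z = az.eval η / (bz.eval η * g.eval η ^ k))
    (G : Finset Ω) (hG : ∀ g' ∈ G,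
      (∃ q : Polynomial Ω, q.Monic ∧
        (∀ k, q.coeff k ∈ locAway (Algebra.adjoin (V.toSubring ⊓ m.toSubring : Subring Ω)
          ({(x - a₀) / c₀} : Set Ω)) u hu) ∧ q.eval g' = 0) ∧
      ∃ w ∈ Algebra.adjoin (V.toSubring ⊓ m.toSubring : Subring Ω) ({(x - a₀) / c₀} : Set Ω),
        w ≠ 0 ∧ w * g' ∈ Algebra.adjoin (V.toSubring ⊓ m.toSubring : Subring Ω)
          ({(x - a₀) / c₀, η} : Set Ω)) :
    ∃ (T : Subalgebra (V.toSubring ⊓ m.toSubring : Subring Ω) Ω),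
      Algebra.Smooth (V.toSubring ⊓ m.toSubring : Subring Ω) T ∧ IsIntegrallyClosed T ∧
      T.toSubring ≤ V.toSubring ∧ (x - a₀) / c₀ ∈ T ∧ η ∈ T ∧ (∀ z ∈ Z, z ∈ T) ∧
      (∀ g' ∈ G, g' ∈ T) ∧
      ∃ D ∈ Algebra.adjoin (V.toSubring ⊓ m.toSubring : Subring Ω) ({(x - a₀) / c₀, η} : Set Ω),
        V.valuation D = 1 ∧ ∀ w ∈ T, ∃ N : ℕ,
        w * D ^ N ∈ Algebra.adjoin (V.toSubring ⊓ m.toSubring : Subring Ω)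
          ({(x - a₀) / c₀, η} : Set Ω) := by
  classical
  set Om : Subring Ω := V.toSubring ⊓ m.toSubring with hOm
  set x' : Ω := (x - a₀) / c₀ with hx'
  set B₀ : Subalgebra Om Ω := Algebra.adjoin Om ({x'} : Set Ω) with hB₀
  set B : Subalgebra Om Ω := locAway B₀ u hu with hBdef
  have hu0 : u ≠ 0 := fun h0 => by rw [h0, map_zero] at hvu; exact zero_ne_one hvu
  -- `B` is an integrally closed domain
  haveI : IsIntegrallyClosed Om := isIntegrallyClosed_inf V m
  haveI hicB₀ : IsIntegrallyClosed B₀ :=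
    IsIntegrallyClosed.of_equiv (Polynomial.algEquivOfTranscendental Om x' htr).toRingEquiv
  haveI hicB : IsIntegrallyClosed B := isIntegrallyClosed_locAway hu0
  haveI : IsDomain B := Function.Injective.isDomain (algebraMap B Ω) Subtype.val_injective
  have hB₀B : B₀ ≤ B := le_locAway
  have hOmB : ∀ z : Ω, z ∈ V → z ∈ m → z ∈ B := fun z hzV hzm =>
    B.algebraMap_mem ⟨z, Subring.mem_inf.mpr ⟨hzV, hzm⟩⟩
  ------------------------------------------------------------------
  -- `η` is integral over `B`; its minimal polynomial `μ` and the factorization `f = μ f₃`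
  ------------------------------------------------------------------
  have hlifts : ∀ P : Polynomial Ω, (∀ k, P.coeff k ∈ B) → P ∈ Polynomial.lifts (algebraMap B Ω) :=
    fun P hP => (Polynomial.lifts_iff_coeff_lifts P).mpr fun k => ⟨⟨P.coeff k, hP k⟩, rfl⟩
  have hlift : ∀ P : Polynomial Ω, (∀ k, P.coeff k ∈ B) →
      ∃ Q : Polynomial B, Q.map (algebraMap B Ω) = P :=
    fun P hP => (Polynomial.mem_lifts P).mp (hlifts P hP)
  obtain ⟨fB, hfB, -, hfBmon⟩ :=
    Polynomial.lifts_and_degree_eq_and_monic (hlifts f fun k => hcoef f (by simp) k) hfmon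
  have hfBη : aeval η fB = 0 := by
    rw [aeval_def, ← eval_map, hfB, hfη]
  have hint : IsIntegral B η := ⟨fB, hfBmon, by rw [← aeval_def, hfBη]⟩
  set μ : Polynomial B := minpoly B η with hμ
  have hμmon : μ.Monic := minpoly.monic hint
  obtain ⟨f₃, hf₃⟩ := minpoly.isIntegrallyClosed_dvd hint hfBη
  set f₂ : Polynomial Ω := μ.map (algebraMap B Ω) with hf₂
  set f₃Ω : Polynomial Ω := f₃.map (algebraMap B Ω) with hf₃Ω
  have hff : f = f₂ * f₃Ω := by rw [← hfB, hf₃, Polynomial.map_mul]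
  have hf₂mon : f₂.Monic := hμmon.map _
  have hf₂η : f₂.eval η = 0 := by
    rw [hf₂, eval_map, ← aeval_def]; exact minpoly.aeval B η
  have hmapcoef : ∀ (q : Polynomial B) (k : ℕ), (q.map (algebraMap B Ω)).coeff k ∈ B := by
    intro q k; rw [coeff_map]; exact (q.coeff k).2
  -- lifts of `h`, `p₂`
  obtain ⟨hB, hhB⟩ := hlift h (fun k => hcoef h (by simp) k)
  obtain ⟨p₂B, hp₂B⟩ := hlift p₂ (fun k => hcoef p₂ (by simp) k)
  -- the new identity `f₂′ h₂ + f₂ q₂ = gˢ`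
  set h₂ : Polynomial Ω := f₃Ω * h with hh₂
  set q₂ : Polynomial Ω := derivative f₃Ω * h + f₃Ω * p₂ with hq₂
  have hident₂ : derivative f₂ * h₂ + f₂ * q₂ = g ^ s := by
    rw [← hident, hff, derivative_mul, hh₂, hq₂]; ring
  have hh₂coef : ∀ k, h₂.coeff k ∈ B := by
    intro k
    have : h₂ = (f₃ * hB).map (algebraMap B Ω) := by
      rw [Polynomial.map_mul, hh₂, hf₃Ω, hhB]
    rw [this]; exact hmapcoef _ k
  have hq₂coef : ∀ k, q₂.coeff k ∈ B := by
    intro k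
    have : q₂ = (derivative f₃ * hB + f₃ * p₂B).map (algebraMap B Ω) := by
      rw [Polynomial.map_add, Polynomial.map_mul, Polynomial.map_mul, ← derivative_map, hq₂, hf₃Ω,
        hhB, hp₂B]
    rw [this]; exact hmapcoef _ k
  have hcoef₂ : ∀ Q ∈ ({f₂, g, h₂, q₂} : Set (Polynomial Ω)), ∀ k, Q.coeff k ∈ B := by
    intro Q hQ k
    simp only [Set.mem_insert_iff, Set.mem_singleton_iff] at hQ
    rcases hQ with hQ | hQ | hQ | hQ <;> rw [hQ]
    · exact hmapcoef μ k
    · exact hcoef g (by simp) k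
    · exact hh₂coef k
    · exact hq₂coef k
  ------------------------------------------------------------------
  -- minimality of `f₂` over `E = m(x)`: clear denominators into `B`, then `μ ∣ ·`
  ------------------------------------------------------------------
  set E : Subfield Ω := Subfield.closure ((m : Set Ω) ∪ {x}) with hE
  -- every element of `E` is `n / d` with `n, d ∈ B`, `d ≠ 0`
  have hfracE : ∀ r ∈ E, ∃ n ∈ B, ∃ d ∈ B, d ≠ 0 ∧ r = n / d := by
    intro r hr
    obtain ⟨y, hy, w, hw, hw0, hyw⟩ := exists_div_of_mem_closure_insert m hr
    have hy' : y ∈ Algebra.adjoin m ({x'} : Set Ω) := adjoin_x_le_adjoin_x' m ha₀ hc₀ hc₀0 hy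
    have hw' : w ∈ Algebra.adjoin m ({x'} : Set Ω) := adjoin_x_le_adjoin_x' m ha₀ hc₀ hc₀0 hw
    obtain ⟨e₁, he₁m, he₁V, he₁0, he₁y⟩ := exists_mul_mem_adjoin_integers_of_mem_adjoin V m _ hy'
    obtain ⟨e₂, he₂m, he₂V, he₂0, he₂w⟩ := exists_mul_mem_adjoin_integers_of_mem_adjoin V m _ hw'
    refine ⟨e₂ * (e₁ * y), B.mul_mem (hOmB _ he₂V he₂m) (hB₀B he₁y),
      e₁ * (e₂ * w), B.mul_mem (hOmB _ he₁V he₁m) (hB₀B he₂w),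
      mul_ne_zero he₁0 (mul_ne_zero he₂0 hw0), ?_⟩
    rw [hyw]
    field_simp
  have hfmin₂ : ∀ Q : Polynomial Ω, (∀ k, Q.coeff k ∈ E) → Q ≠ 0 → Q.eval η = 0 →
      f₂.natDegree ≤ Q.natDegree := by
    intro Q hQE hQ0 hQη
    -- denominators
    have hden : ∀ k, ∃ n ∈ B, ∃ d ∈ B, d ≠ 0 ∧ Q.coeff k = n / d := fun k => hfracE _ (hQE k)
    choose n hn d hd hd0 hnd using hden
    set Dn : Ω := ∏ k ∈ Finset.range (Q.natDegree + 1), d k with hDn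
    have hDnB : Dn ∈ B := B.prod_mem fun k _ => hd k
    have hDn0 : Dn ≠ 0 := Finset.prod_ne_zero_iff.mpr fun k _ => hd0 k
    set Q' : Polynomial Ω := C Dn * Q with hQ'
    have hQ'0 : Q' ≠ 0 := mul_ne_zero (by rwa [Ne, C_eq_zero]) hQ0
    have hQ'η : Q'.eval η = 0 := by rw [hQ', eval_mul, hQη, mul_zero]
    have hQ'deg : Q'.natDegree = Q.natDegree := by rw [hQ', natDegree_C_mul hDn0]
    have hQ'coef : ∀ k, Q'.coeff k ∈ B := by
      intro k
      rw [hQ', coeff_C_mul]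
      by_cases hk : k ∈ Finset.range (Q.natDegree + 1)
      · rw [hnd k, hDn, ← Finset.mul_prod_erase _ _ hk]
        have : d k * (∏ j ∈ (Finset.range (Q.natDegree + 1)).erase k, d j) * (n k / d k) =
            (∏ j ∈ (Finset.range (Q.natDegree + 1)).erase k, d j) * n k := by
          calc d k * (∏ j ∈ (Finset.range (Q.natDegree + 1)).erase k, d j) * (n k / d k)
              = (∏ j ∈ (Finset.range (Q.natDegree + 1)).erase k, d j) * (d k * (n k / d k)) := by
                ring
            _ = _ := by rw [mul_div_cancel₀ _ (hd0 k)]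
        rw [this]
        exact B.mul_mem (B.prod_mem fun j _ => hd j) (hn k)
      · have : Q.coeff k = 0 := by
          refine coeff_eq_zero_of_natDegree_lt ?_
          simpa [Finset.mem_range] using hk
        rw [this, mul_zero]; exact B.zero_mem
    obtain ⟨QB, hQB⟩ := hlift Q' hQ'coef
    have hQBη : aeval η QB = 0 := by
      rw [aeval_def, ← eval_map, hQB, hQ'η]
    have hQB0 : QB ≠ 0 := by
      intro h0
      apply hQ'0
      rw [← hQB, h0, Polynomial.map_zero]
    have hdvd : μ ∣ QB := minpoly.isIntegrallyClosed_dvd hint hQBη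
    have hdeg : μ.natDegree ≤ QB.natDegree := natDegree_le_of_dvd hdvd hQB0
    have hμdeg : f₂.natDegree = μ.natDegree := by
      rw [hf₂, natDegree_map_eq_of_injective Subtype.val_injective]
    have hQBdeg : QB.natDegree = Q'.natDegree := by
      rw [← hQB, natDegree_map_eq_of_injective Subtype.val_injective]
    rw [hμdeg, ← hQ'deg, ← hQBdeg]
    exact hdeg
  ------------------------------------------------------------------
  -- apply the chart with `f₂`
  ------------------------------------------------------------------
  exact exists_EChart_with_members V m hxaV htr hu hvu hηV f₂ g h₂ q₂ s hf₂mon hf₂η hcoef₂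
    hfmin₂ hident₂ hvg ha₀ hc₀ Z hZ G hG

end Literature.AlgebraicGeometry.Resolution

end
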